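import Summits.BirchSwinnertonDyer.BirchSwinnertonDyer.Theses.UniversalToricDescent
import Summits.BirchSwinnertonDyer.BirchSwinnertonDyer.Theorems.UniversalToricDescentToricTransportModThreeStubRatSqueeze
import Literature.NumberTheory.DiophantineGeometry.LocalReduction
import Literature.NumberTheory.GaloisRepresentations.AbsGaloisGroup
import HarnessLib

/-!
# NODE `tame_mu_descent` — crux `AdditiveSplitIMCInclusionAtThree` (stmt-BirchSwinnertonDyer-20395, THE WALL, UTD)
# crux-ideate round 24 (unit cruxidea-stmt-BirchSwinnertonDyer-20395-1-g24), 2026-08-31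

NODE for the crux idea `tame-mu-descent` (card `Ideas/tame-mu-descent.md`, line card `Lines/tame_mu_descent.md`).

THE LINE.  By the g7 structural theorem `wall_iff_ratwall_and_muDominance` the wall is
`RationalSplitIMCInclusionAtThree` (24207, the rational half, live LEAD) ∧ the μ-half; in g3's currency the μ-half is
implied by `SelfAlgMuZeroAtThree` (`X := X_(∅,0)(E/K_∞)` strict at `𝔭′` is `Λ`-torsion with `μ = 0`).  This node
pays the μ-half UPSTAIRS and brings it down for free:

* (T2, ATTACKABLE) on an odd-tamable row a TAMING LIFT exists: a CM field `F′ = F·K ⊇ K` of ODD relative degree (`F`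
  totally real with ONE prime `w ∣ 3`, `F_w ⊇` an odd-degree field of good reduction of `E`) over which `E` has GOOD
  (necessarily supersingular, `j̃ = 0`) reduction above `3`, linearly disjoint from `K_∞` (`κ′ := κ ∘ res` is still onto
  `ℤ₃`, so `F′K_∞/F′` is a `ℤ₃`-extension over THE SAME `Λ`), with a unique prime `𝔓′ ∣ 𝔭′`, and `ρ̄_{E,3}|G_{F′}`
  irreducible;
* (T3, ATTACKABLE — the lever, pure Galois cohomology + `Λ`-algebra) μ DESCENDS AS AN INEQUALITY along ANY such lift:
  `res : Sel_(∅,0)(K_∞) → Sel_(∅,0)(F′K_∞)` has finite kernel (inflation–restriction through the Galois closure,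
  `E(F′K_∞)[3] = 0` because a pro-3 group acting on a non-zero finite 3-group has a fixed point and `E(F′)[3] = 0`),
  so `X(E/K_∞)` is, up to a finite module, a quotient of `X(E/F′K_∞)` viewed over the same `Λ`; torsion-ness and
  `μ = 0` pass to quotients and finite extensions — no character decomposition, no `⊗ℚ₃`, no semisimplicity of
  `ℤ₃[Gal]` is used (contrast g5 `cubic_unwinding` T2 docstring «μ-parts do not descend»: EQUALITY does not, the
  INEQUALITY `μ_Λ(X_K) ≤ μ_Λ(X_{F′})` does);
* (T4, UNDECIDED — the residual, IDEA-NEEDED) UPSTAIRS self-`μ = 0`: `X_(∅,0)(E/F′K_∞)` strict at `𝔓′` is `Λ`-torsion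
  with `μ = 0` — anticyclotomic Iwasawa theory of `E/F′` at primes `w ∣ 3` of GOOD SUPERSINGULAR reduction over a
  (wildly) ramified base: the local representation is CRYSTALLINE over `F′_w`, so integral `p`-adic Hodge theory over
  the Lubin–Tate / Breuil–Kisin base `𝓞_{F′_w}` (signed Coleman maps, Kobayashi–Ota integral Perrin-Riou twists,
  three-term norm relations of CM points on the Shimura curve over `F`) replaces the Λ-adic class that does not exist
  downstairs (TraceZero, `U₃ f = 0`); analytic partner: for abelian `F` the upstairs BDP function factors through
  `∏_ψ L_𝔭(f ⊗ ψ)` and Hsieh's `μ = 0` (tree, any level) — see the line card for the sub-leaves T4a/T4b/T4c;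
* (T1, WEAKER) `RationalSplitIMCInclusionAtThree` BY NAME;
* (T0, WEAKER by restriction) the wall OFF the odd-tamable rows — PARITY LOCK: a μ-descent needs a `Λ`-TORSION module
  upstairs, i.e. an INDEFINITE lift, i.e. `[F′⁺:ℚ]` odd (`ε = (−1)^{[F′⁺:ℚ]}`), i.e. a taming by an odd-degree field,
  which exists exactly on the Kraus `Φ = C₃` rows (`OddTamableRow`); on `Φ = C₆, Dic₁₂` every CM taming lift is definite,
  `X_(∅,0)` upstairs has `Λ`-rank one and there is nothing to descend — those rows stay with the LEAD.

KERNEL (no `sorry` outside the five `stub_*`): `selfMuZeroOnOddRows_of_lift : T2 → T3 → T4 → SelfMuZeroOnOddTamableRows`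
(the DOOR: g3's currency restricted to the rows, = g5's `SelfMuZeroOnCubicRows` generalised), `wallOnOddRows_of_ratwall_of_selfMu
: T1 → door → WallOnOddTamableRows` (the g3/g13 3-saturation: `prime_C_three`, `not_C_three_dvd_of_norm_coeff_eq_one`,
`dvd_of_dvd_prime_pow_mul`, all LANDED), `wall_of_on_of_off` (excluded middle on the row predicate) and
`AdditiveSplitIMCInclusionAtThree_of : T1 → T0 → T2 → T3 → T4 → AdditiveSplitIMCInclusionAtThree` (the crux BY NAME).

Tags (evidence in the line card): T1 WEAKER (tree theorem `rationalSplitIMCInclusionAtThree_of_wall`), T0 WEAKER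
(restriction; IDEA-NEEDED leaf = the crux on the even rows), T2 WEAKER / ATTACKABLE (field arithmetic: weak approximation +
Krasner; independent of the wall), T3 ATTACKABLE (provable now modulo the `XAc` functoriality API: restriction along
`F′/K`, Pontryagin duality, `μ` of quotients), T4 UNDECIDED → leaves: T4a INSTRUMENTABLE (`a_w ∈ {0, ±3}` and the
semistability field per Kraus cell), T4b IDEA-NEEDED / BARRIER-adjacent (signed / integral supersingular anticyclotomic
theory over a base in which `3` is wildly ramified — nothing in print: [corpus:paper:arxiv-2002.04750 p.3] works over
unramified `𝒦/ℚ_p` and records the Kitajima–Otsuki pathology already for `4 ∣ [𝒦:ℚ_p]`; shared with 24207-g11's leaf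
K_L1), T4c INSTRUMENTABLE (Hsieh `μ = 0` for the nebentypus twists `f ⊗ ψ`, `F` abelian).

References: Hachimori–Matsuno, J. Algebraic Geom. 8 (1999) (Kida's formula for Selmer groups; `μ = 0` ascends
p-extensions) as used in [corpus:book:coates1999-arithmetic-theory-elliptic-curves p.46]; Greenberg LNM 1716 §§3–4;
GreenbergVatsal2000 Prop. 2.8; Kraus 1990 (types at 3); Serre–Tate; Kobayashi 2003; B.D. Kim arXiv:1608.03315;
Kitajima–Otsuki arXiv:1607.03612; Kobayashi–Ota (Adv. Stud. Pure Math. 86); CastellaWan arXiv:1607.02019;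
Hsieh2014 (tree `Hsieh2014.thmB_exists_isHsiehLFunction_coeff_norm_eq_one_unrPeriod_anyLevel`); Washington1997 §13.
-/

set_option linter.dupNamespace false
set_option autoImplicit false

noncomputable section

open Literature.NumberTheory.EllipticCurves
open Literature.NumberTheory.GaloisRepresentations
open Summit.BirchSwinnertonDyer.BirchSwinnertonDyer.Theses.UniversalToricDescent
  (RationalSplitIMCInclusionAtThree AdditiveSplitIMCInclusionAtThree)
open Summit.BirchSwinnertonDyer.BirchSwinnertonDyer.Cruxes.ToricTransportModThree.RatwallThinComb
  (dvd_of_dvd_prime_pow_mul prime_C_three not_C_three_dvd_of_norm_coeff_eq_one)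
open Summit.BirchSwinnertonDyer.Rank1Residual.X11b
open IsDedekindDomain NumberField Field

namespace Summit.BirchSwinnertonDyer.BirchSwinnertonDyer.Cruxes.AdditiveSplitIMCInclusionAtThree.TameMuDescent

/-! ## §0 Objects -/

/-- The SELF-`μ = 0` PACKAGE in the route's `R₀⟦T⟧` currency for an arbitrary number field `F′`, a `ℤ₃`-extension
`κ′` of `F′` with topological generator `γ′`, and a strict prime `𝔓′`: `X_(∅,0)(E/F′_∞)` (relaxed above `3` except
strict at `𝔓′`, `Σ = ∅`) is `Λ`-torsion and `Ch_Λ(X)·R₀⟦T⟧ = (g′)` with a coefficient of `3`-adic norm `1`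
(equivalently `μ = 0`, tree `exists_map_charIdeal_eq_span_of_muInvariant_eq_zero`).  For `F′ = K` this is verbatim the
conclusion of g3's `SelfAlgMuZeroAtThree`. [GreenbergVatsal2000 §2; Washington1997 §13.2] -/
def SelfMuZeroPackage (W : WeierstrassCurve ℚ) (F' : Type) [Field F'] [NumberField F'] (κ' : ZpExtension F' 3)
    (𝔓' : HeightOneSpectrum (𝓞 F')) (γ' : absoluteGaloisGroup F') [Fact (κ'.IsTopGenerator γ')] : Prop :=
  Module.IsTorsion (IwasawaAlgebra 3) (AcSelmer.XAc (W.baseChange F') 3 κ' 𝔓' ∅ γ') ∧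
    ∃ g' : UnrSeries 3,
      (AcSelmer.XAc.charIdeal (W.baseChange F') 3 κ' 𝔓' ∅ γ').map (PowerSeries.map (Halves.toUnr 3)) =
          Ideal.span {g'} ∧
        ∃ i : ℕ, ‖((PowerSeries.coeff i g' : unrIntegers 3) : ℂ_[3])‖ = 1

/-- The TAMING LIFT predicate (no new structure, no instance): `F′ ⊇ K` a finite extension of number fields with
(i) `E/F′` of GOOD reduction at every prime above `3` (the additive, potentially supersingular type of `E` at `3` is
killed: `F′_w` contains the semistability field; for ClassO6 rows `3 ∣ e(w∣3)`, so the lift is WILDLY ramified);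
(ii) `κ′ = κ ∘ res_{F′/K}` (a `ℤ₃`-extension of `F′` by the type's surjectivity field, i.e. `F′ ∩ K_∞ = K` and
`F′_∞ = F′·K_∞` is a `ℤ₃`-extension over THE SAME `Λ`); (iii) `𝔓′` is THE unique prime of `F′` over the strict prime
`𝔭′` (so «strict at `𝔓′`» upstairs is «strict above `𝔭′`»); (iv) `ρ̄_{E,3}|G_{F′}` irreducible (hence
`E(F′)[3] = 0`, hence `E(F′_∞)[3] = 0` since `Gal(F′_∞/F′)` is pro-`3`; and no `3`-isogeny appears over `F′`, which is
what keeps the upstairs `μ` honest); (v) `F′` is a CM field (intended `F′ = F·K`, `F = F′⁺` totally real) and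
(vi) `[F′ : K]` is ODD — the PARITY LOCK: all primes of `F′⁺` dividing `cond(E)` split in `F′ = F′⁺K` (Heegner hypothesis
for `K`, good reduction above `3`), so `ε(E/F′, χ) = (−1)^{[F′⁺:ℚ]}` for the finite-order characters `χ` of the `K`-line;
odd degree ⇔ sign `−1` ⇔ INDEFINITE ⇔ `X_(∅,0)(E/F′_∞)` is expected `Λ`-TORSION (even degree is definite: the BDP branch
vanishes identically on the line and `X_(∅,0)` has `Λ`-rank one — useless for a μ-descent, cf. g23 N5 / 24207 B-g11-1).
[Kraus1990 Thm. 1; SerreTate1968 §2; Washington1997 §13.1; Gross1988 §11 (signs); AgboolaHoward2006 (definite vs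
indefinite ranks at split p)] -/
def IsTamingLift (W : WeierstrassCurve ℚ) (K : Type) [Field K] [NumberField K] (F' : Type) [Field F']
    [NumberField F'] [Algebra K F'] (κ : ZpExtension K 3) (κ' : ZpExtension F' 3)
    (𝔭' : HeightOneSpectrum (𝓞 K)) (𝔓' : HeightOneSpectrum (𝓞 F')) : Prop :=
  (∀ w : HeightOneSpectrum (𝓞 F'), ((3 : ℕ) : 𝓞 F') ∈ w.asIdeal → (W.baseChange F').HasGoodReductionAt w) ∧
  (∀ σ : absoluteGaloisGroup F', κ' σ = κ (absGaloisRestrict K F' σ)) ∧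
  (∀ w : HeightOneSpectrum (𝓞 F'), w.asIdeal.comap (algebraMap (𝓞 K) (𝓞 F')) = 𝔭'.asIdeal ↔ w = 𝔓') ∧
  (W.baseChange F').HasIrreducibleModPGaloisRep 3 ∧
  IsCMField F' ∧ Odd (Module.finrank K F')

/-- The ODD-TAMABLE ROW PREDICATE (census-decidable; Kraus `Φ = C₃` on ClassO6 rows): `E` acquires GOOD reduction above
`3` over SOME number field of ODD degree.  Equivalently the semistability defect group `Φ = ρ_E(I₃) ⊂ SL₂(𝔽_ℓ)` has odd
order, i.e. (`3 ∣ #Φ` on ClassO6) `Φ = C₃` (`v₃(Δ_min) ≡ 0 mod 4`, Kodaira II / II* / IV / IV* with the cubic resolvent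
ramified): the order-`4` elements of `C₆ ⊃ {±1}`, `Dic₁₂` survive every odd extension.  It contains g5's `CubicRow`
(cyclic cubic taming, `ℚ(ζ₉)⁺`) and 24207-g11's `TamableByCubic` (non-Galois cubic taming). [Kraus1990 Thm. 1;
SerreTate1968 §2 Cor. 2] -/
def OddTamableRow (W : WeierstrassCurve ℚ) : Prop :=
  ∃ (F : Type) (_ : Field F) (_ : NumberField F), Odd (Module.finrank ℚ F) ∧
    ∀ w : HeightOneSpectrum (𝓞 F), ((3 : ℕ) : 𝓞 F) ∈ w.asIdeal → (W.baseChange F).HasGoodReductionAt w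

/-! ## §1 The pieces (statements) -/

-- T1 (WEAKER) is the route item `RationalSplitIMCInclusionAtThree` (24207) BY NAME — no local copy; the tree theorem
-- `UniversalToricDescentRationalSplitIMCInclusionAtThreeOfWall.rationalSplitIMCInclusionAtThree_of_wall` proves
-- wall ⇒ T1, so T1 is certifiably WEAKER.

/-- T2 (WEAKER · ATTACKABLE, M — field arithmetic, independent of the wall): on an odd-tamable row, under the wall's
hypotheses on `(E, K, κ, 𝔭, 𝔭′)`, an (odd, CM) taming lift `(F′, κ′, 𝔓′)` EXISTS.  Construction: from the row predicate
take `w ∣ 3` of the odd-degree field `F₀` with `[F₀,w : ℚ₃]` odd and put `M := F₀,w` (`E/M` good); choose a TOTALLY REAL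
`F` with `F ⊗ ℚ₃ ≅ M` (one prime over `3`; weak approximation on a defining polynomial: real-rootedness is open in `ℝⁿ`,
`M`-generation is open in `ℚ₃ⁿ` by Krasner), `[F:ℚ] = [M:ℚ₃]` odd; `F′ := F·K` (CM, `[F′:K]` odd), `κ′ := κ ∘ res` (onto
`ℤ₃`: `F′ ∩ K_∞ = K`, e.g. because the layers `K_n/ℚ` are dihedral while `F` can be taken cyclic (`ℚ(ζ₉)⁺` on g5's rows) or
with `S_d`-closure), `𝔓′` := the unique prime over `𝔭′` (`F′ ⊗_K K_{𝔭′} = M` is a field because `𝔭′` is split: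
`K_{𝔭′} = ℚ₃`), irreducibility of `ρ̄|G_{F′}`: every Galois subfield `≠ ℚ` of `ℚ(E[3])` contains `ℚ(√−3)` (the normal
subgroups `{±1}, Q₈, SL₂` of `GL₂(𝔽₃)` lie in `SL₂ = ker det`), and `√−3 ∉ F̃K` once the quadratic resolvent of `F̃` avoids
`ℚ(√(3 d_K))` (`K ≠ ℚ(√−3)` as `3` splits in `K`).  [Kraus1990; Krasner; Washington1997 §13.1; Serre1972 §5.3]
(why it might fail: only by mis-typing of the lift predicate — each clause is an open / cofinite condition on `F`.) -/
def OddTamingLiftExists : Prop :=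
  ∀ (W : WeierstrassCurve ℚ) [W.IsElliptic] [W.IsGloballyMinimal],
    Summit.BirchSwinnertonDyer.Rank1Residual.Additive.ClassO6 W 3 → W.HasSurjectiveModNGaloisRep 3 → OddTamableRow W →
    ∀ (K : Type) [Field K] [NumberField K], Literature.NumberTheory.EllipticCurves.IsImaginaryQuadratic K →
    ∀ (κ : Literature.NumberTheory.EllipticCurves.ZpExtension K 3), κ.IsAnticyclotomic →
    ∀ (𝔭 : IsDedekindDomain.HeightOneSpectrum (NumberField.RingOfIntegers K)),
      ((3 : ℕ) : NumberField.RingOfIntegers K) ∈ 𝔭.asIdeal →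
      𝔭.asIdeal.ramificationIdx (NumberField.RingOfIntegers ℚ) = 1 →
      𝔭.asIdeal.inertiaDeg (NumberField.RingOfIntegers ℚ) = 1 →
    ∀ (𝔭' : IsDedekindDomain.HeightOneSpectrum (NumberField.RingOfIntegers K)),
      ((3 : ℕ) : NumberField.RingOfIntegers K) ∈ 𝔭'.asIdeal → 𝔭' ≠ 𝔭 →
    ∃ (F' : Type) (_ : Field F') (_ : NumberField F') (_ : Algebra K F') (κ' : ZpExtension F' 3)
      (𝔓' : HeightOneSpectrum (𝓞 F')), IsTamingLift W K F' κ κ' 𝔭' 𝔓'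

/-- T3 (ATTACKABLE, M — THE LEVER; pure Galois cohomology + `Λ`-module algebra, no `L`-function): along ANY taming lift
the self-`μ = 0` package DESCENDS from `F′_∞ = F′·K_∞` to `K_∞`.  Proof sketch (to be formalised against the `XAc` API):
(1) `res : Sel_(∅,0)(K_∞, E[3^∞]) → Sel_(∅,0)(F′_∞, E[3^∞])` is well defined (local conditions: ∅ above `𝔭` on both
sides; strict at `𝔭′` ↦ strict at the unique `𝔓′ ∣ 𝔭′`; unramified elsewhere ↦ unramified) and has FINITE kernel —
it factors through the Galois closure `F̃′_∞/K_∞`, where the kernel is `H¹(Gal(F̃′_∞/K_∞), E(F̃′_∞)[3^∞])`, finite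
because `E(F̃′_∞)[3^∞]` is finite (irreducibility (iv) + pro-`3` fixed points; enlarge (iv) to the closure if needed);
(2) Pontryagin duality: `X(E/F′_∞) ⊇ (image) ↠ X(E/K_∞)` up to a finite cokernel, as modules over the SAME
`Λ = ℤ₃⟦Γ⟧` (`Γ = Gal(K_∞/K) = Gal(F′_∞/F′)` via (ii); the generator change `γ ↦ γ′` is a `Λ`-automorphism and
does not affect torsion-ness or `μ`); (3) finitely generated torsion upstairs ⇒ torsion downstairs; `μ_Λ(X_K) ≤
μ_Λ(quotient) ≤ μ_Λ(X_{F′}) = 0` (characteristic ideals of quotients divide; `μ = 0` ⇔ a generator of `Ch·R₀⟦T⟧` has a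
unit coefficient, tree `exists_map_charIdeal_eq_span_of_muInvariant_eq_zero` / `charIdeal_isPrincipal_holds`).
CORRECTS the banked remark of `Lines/cubic_unwinding.lean` (T2 docstring) «μ-parts do not descend along the cubic
layer»: the EQUALITY / character-wise splitting does not, the INEQUALITY does, and the inequality is all the wall needs.
[Hachimori–Matsuno 1999 §3 (the harder ASCENT `μ = 0 ⇒ μ = 0` up a p-extension, quoted in
[corpus:book:coates1999-arithmetic-theory-elliptic-curves p.46]); Greenberg LNM 1716 Lemma 3.1–3.3; GreenbergVatsal2000
Prop. 2.8; Washington1997 §13.2 Lemma 13.18–13.21]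
(why it might fail: only through the typed objects — if `AcSelmer.XAc` over `F′` with `Σ = ∅` imposes at the OTHER
primes above `3` (those over `𝔭`) a condition finer than «no condition», the restriction map must be checked there; for
the intended `F′` there is ONE prime over `𝔭` as well and the condition is ∅ on both sides.) -/
def MuDescendsAlongLift : Prop :=
  ∀ (W : WeierstrassCurve ℚ) [W.IsElliptic] [W.IsGloballyMinimal] (K : Type) [Field K] [NumberField K],
    W.HasSurjectiveModNGaloisRep 3 → Literature.NumberTheory.EllipticCurves.IsImaginaryQuadratic K →
    ∀ (κ : Literature.NumberTheory.EllipticCurves.ZpExtension K 3), κ.IsAnticyclotomic →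
    ∀ (γ : Field.absoluteGaloisGroup K) [Fact (κ.IsTopGenerator γ)]
      (𝔭' : IsDedekindDomain.HeightOneSpectrum (NumberField.RingOfIntegers K)),
      ((3 : ℕ) : NumberField.RingOfIntegers K) ∈ 𝔭'.asIdeal →
    ∀ (F' : Type) [Field F'] [NumberField F'] [Algebra K F'] (κ' : ZpExtension F' 3)
      (γ' : absoluteGaloisGroup F') [Fact (κ'.IsTopGenerator γ')] (𝔓' : HeightOneSpectrum (𝓞 F')),
      IsTamingLift W K F' κ κ' 𝔭' 𝔓' →
    SelfMuZeroPackage W F' κ' 𝔓' γ' → SelfMuZeroPackage W K κ 𝔭' γ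

/-- T4 (UNDECIDED — THE RESIDUAL; leaves T4a INSTRUMENTABLE, T4b IDEA-NEEDED / BARRIER-adjacent, T4c INSTRUMENTABLE, see
the line card): UPSTAIRS self-`μ = 0`.  For every ClassO6 row under the wall's hypotheses and every (odd, CM — hence
INDEFINITE) taming lift `(F′, κ′, 𝔓′)`, `X_(∅,0)(E/F′_∞)` strict at `𝔓′` is `Λ`-torsion with `μ = 0`.  Upstairs `E` has GOOD SUPERSINGULAR
reduction at the primes `w ∣ 3` of `F′` (`j̃ = 0`, `a_w ∈ {0, ±3}` over the residue field `𝔽₃` of the totally ramified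
`F′_w`), each `w` split in the CM extension `F′/F` (`F := ` the maximal totally real subfield) — the «`p`-ordinary CM
type» shape of BDP / Castella–Hsieh / Kobayashi–Ota, but over a base in which `3` is WILDLY ramified.  Intended proof
shape: T4b an upstairs Kolyvagin-direction inequality `μ(X_(∅,0)(E/F′_∞)) ≤ μ(ℒ_w(E/F′))` from a signed / integral
Perrin-Riou-twisted CM-point Euler system on the Shimura curve over `F` attached to `E/F` (three-term norm relations at
a GOOD supersingular prime: `Tr y_{m+1} = a_w y_m − y_{m−1}`, NOT trace-zero), read through signed Coleman maps over the
Lubin–Tate tower of `F′_w` (crystalline representation ⇒ Wach/Breuil–Kisin modules over `𝓞_{F′_w}` exist); T4c the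
analytic `μ(ℒ_w(E/F′)) = 0` — for ABELIAN `F` by Artin factorisation `ℒ(E/F′)|_{line} ≐ ∏_ψ L_𝔭(f ⊗ ψ/K)` over the
characters `ψ` of `Gal(F/ℚ)` and Hsieh's `μ = 0` at any level (tree fact, nebentypus `ψ²` to be checked), in general by
Hida–Hsieh over the CM field `F′`; T4a the census of `(a_w, F_w)` per Kraus cell.  [Kobayashi2003; B.D. Kim
arXiv:1608.03315; Kitajima–Otsuki arXiv:1607.03612; Kobayashi–Ota ASPM 86; CastellaWan arXiv:1607.02019; BDP2013;
CastellaHsieh2018; Hsieh2014 Thm. B; Hida2010 (μ of Katz L-functions); Disegni / YZZ over totally real fields]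
(why it might fail: `μ > 0` upstairs is excluded by no theorem; every signed construction in print needs the base
unramified at `p` ([corpus:paper:arxiv-2002.04750 p.3]: «`𝒦/ℚ_p` unramified», and `E⁺` not even cofree when
`4 ∣ [𝒦:ℚ_p]`); at `e(w∣3) ∈ {3, 6, 12}` the formal-group filtration jumps differently and the `±` splitting of local
points may simply not exist — then T4b needs a genuinely new integral structure (e.g. `(φ, Γ_{LT})`-modules over the
Lubin–Tate extension of `F′_w`, Schneider–Venjakob regulator maps [galaxy:pdf:-4298793924716451140]).) -/
def UpstairsSelfMuZero : Prop :=
  ∀ (W : WeierstrassCurve ℚ) [W.IsElliptic] [W.IsGloballyMinimal] (N : ℕ) [NeZero N] (K : Type) [Field K]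
    [NumberField K] (Dt : Literature.NumberTheory.EllipticCurves.ModularForms.ModularParametrizationData W N),
    Summit.BirchSwinnertonDyer.Rank1Residual.Additive.ClassO6 W 3 → W.HasSurjectiveModNGaloisRep 3 →
    W.analyticRank = 1 → W.conductorNorm ℤ = N → Literature.NumberTheory.EllipticCurves.IsImaginaryQuadratic K →
    Literature.NumberTheory.EllipticCurves.SatisfiesHeegnerHypothesis N K →
    ∀ (κ : Literature.NumberTheory.EllipticCurves.ZpExtension K 3), κ.IsAnticyclotomic →
    ∀ (𝔭 : IsDedekindDomain.HeightOneSpectrum (NumberField.RingOfIntegers K)),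
      ((3 : ℕ) : NumberField.RingOfIntegers K) ∈ 𝔭.asIdeal →
      𝔭.asIdeal.ramificationIdx (NumberField.RingOfIntegers ℚ) = 1 →
      𝔭.asIdeal.inertiaDeg (NumberField.RingOfIntegers ℚ) = 1 →
    ∀ (𝔭' : IsDedekindDomain.HeightOneSpectrum (NumberField.RingOfIntegers K)),
      ((3 : ℕ) : NumberField.RingOfIntegers K) ∈ 𝔭'.asIdeal → 𝔭' ≠ 𝔭 →
    ∀ (F' : Type) [Field F'] [NumberField F'] [Algebra K F'] (κ' : ZpExtension F' 3)
      (γ' : absoluteGaloisGroup F') [Fact (κ'.IsTopGenerator γ')] (𝔓' : HeightOneSpectrum (𝓞 F')),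
      IsTamingLift W K F' κ κ' 𝔭' 𝔓' →
    SelfMuZeroPackage W F' κ' 𝔓' γ'

/-- THE DOOR THIS NODE FEEDS: g3's `SelfAlgMuZeroAtThree` RESTRICTED TO ODD-TAMABLE ROWS (generalises g5's
`CubicUnwinding.SelfMuZeroOnCubicRows`, there a WEAKER piece «fed by the toothwise children or by 24737 twin transport»;
here fed by T2 + T3 + T4: lift, descend, pay upstairs). -/
def SelfMuZeroOnOddTamableRows : Prop :=
  ∀ (W : WeierstrassCurve ℚ) [W.IsElliptic] [W.IsGloballyMinimal] (N : ℕ) [NeZero N] (K : Type) [Field K]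
    [NumberField K] (Dt : Literature.NumberTheory.EllipticCurves.ModularForms.ModularParametrizationData W N),
    Summit.BirchSwinnertonDyer.Rank1Residual.Additive.ClassO6 W 3 → W.HasSurjectiveModNGaloisRep 3 → OddTamableRow W →
    W.analyticRank = 1 → W.conductorNorm ℤ = N → Literature.NumberTheory.EllipticCurves.IsImaginaryQuadratic K →
    Literature.NumberTheory.EllipticCurves.SatisfiesHeegnerHypothesis N K →
    ∀ (κ : Literature.NumberTheory.EllipticCurves.ZpExtension K 3), κ.IsAnticyclotomic →
    ∀ (γ : Field.absoluteGaloisGroup K) [Fact (κ.IsTopGenerator γ)]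
      (𝔭 : IsDedekindDomain.HeightOneSpectrum (NumberField.RingOfIntegers K)),
      ((3 : ℕ) : NumberField.RingOfIntegers K) ∈ 𝔭.asIdeal →
      𝔭.asIdeal.ramificationIdx (NumberField.RingOfIntegers ℚ) = 1 →
      𝔭.asIdeal.inertiaDeg (NumberField.RingOfIntegers ℚ) = 1 →
    ∀ (𝔭' : IsDedekindDomain.HeightOneSpectrum (NumberField.RingOfIntegers K)),
      ((3 : ℕ) : NumberField.RingOfIntegers K) ∈ 𝔭'.asIdeal → 𝔭' ≠ 𝔭 →
    SelfMuZeroPackage W K κ 𝔭' γ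

/-- THE WALL ON ODD-TAMABLE ROWS (the crux with the extra hypothesis `OddTamableRow W`; WEAKER by restriction). -/
def WallOnOddTamableRows : Prop :=
  ∀ (W : WeierstrassCurve ℚ) [W.IsElliptic] [W.IsGloballyMinimal] (N : ℕ) [NeZero N] (K : Type) [Field K]
    [NumberField K] (Dt : Literature.NumberTheory.EllipticCurves.ModularForms.ModularParametrizationData W N),
    Summit.BirchSwinnertonDyer.Rank1Residual.Additive.ClassO6 W 3 → W.HasSurjectiveModNGaloisRep 3 → OddTamableRow W →
    W.analyticRank = 1 → W.conductorNorm ℤ = N → Literature.NumberTheory.EllipticCurves.IsImaginaryQuadratic K →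
    Literature.NumberTheory.EllipticCurves.SatisfiesHeegnerHypothesis N K →
    ∀ (κ : Literature.NumberTheory.EllipticCurves.ZpExtension K 3), κ.IsAnticyclotomic →
    ∀ (γ : Field.absoluteGaloisGroup K) [Fact (κ.IsTopGenerator γ)]
      (𝔭 : IsDedekindDomain.HeightOneSpectrum (NumberField.RingOfIntegers K)),
      ((3 : ℕ) : NumberField.RingOfIntegers K) ∈ 𝔭.asIdeal →
      𝔭.asIdeal.ramificationIdx (NumberField.RingOfIntegers ℚ) = 1 →
      𝔭.asIdeal.inertiaDeg (NumberField.RingOfIntegers ℚ) = 1 →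
    ∀ (𝔭' : IsDedekindDomain.HeightOneSpectrum (NumberField.RingOfIntegers K)),
      ((3 : ℕ) : NumberField.RingOfIntegers K) ∈ 𝔭'.asIdeal → 𝔭' ≠ 𝔭 →
    ∀ (ι' : PadicAlgCl 3 ≃+* ℂ),
      Summit.BirchSwinnertonDyer.BirchSwinnertonDyer.Theorems.SchneiderFree.BranchInducesPrime 3 ι' 𝔭 →
    ∀ (ΩK : ℂ) (Ωp : ℂ_[3]) (L : Literature.NumberTheory.EllipticCurves.UnrSeries 3), ΩK ≠ 0 → Ωp ≠ 0 →
      Literature.NumberTheory.EllipticCurves.IsBDPLFunction ι' 𝔭 κ γ Dt.f ΩK Ωp L →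
    Ideal.span {L} ≤ (AcSelmer.XAc.charIdeal (W.baseChange K) 3 κ 𝔭' ∅ γ).map (PowerSeries.map (Halves.toUnr 3))

/-- T0 (WEAKER by restriction — IDEA-NEEDED leaf, served unchanged by the LEAD 24207 `ratwall_thin_comb` + the other μ-bit
lines): THE WALL OFF THE ODD-TAMABLE ROWS (Kraus `Φ = C₆`, `Dic₁₂`: every taming has even degree, every CM taming lift is
DEFINITE, a μ-descent has nothing torsion to descend from). -/
def WallOffOddTamableRows : Prop :=
  ∀ (W : WeierstrassCurve ℚ) [W.IsElliptic] [W.IsGloballyMinimal] (N : ℕ) [NeZero N] (K : Type) [Field K]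
    [NumberField K] (Dt : Literature.NumberTheory.EllipticCurves.ModularForms.ModularParametrizationData W N),
    Summit.BirchSwinnertonDyer.Rank1Residual.Additive.ClassO6 W 3 → W.HasSurjectiveModNGaloisRep 3 → ¬ OddTamableRow W →
    W.analyticRank = 1 → W.conductorNorm ℤ = N → Literature.NumberTheory.EllipticCurves.IsImaginaryQuadratic K →
    Literature.NumberTheory.EllipticCurves.SatisfiesHeegnerHypothesis N K →
    ∀ (κ : Literature.NumberTheory.EllipticCurves.ZpExtension K 3), κ.IsAnticyclotomic →
    ∀ (γ : Field.absoluteGaloisGroup K) [Fact (κ.IsTopGenerator γ)]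
      (𝔭 : IsDedekindDomain.HeightOneSpectrum (NumberField.RingOfIntegers K)),
      ((3 : ℕ) : NumberField.RingOfIntegers K) ∈ 𝔭.asIdeal →
      𝔭.asIdeal.ramificationIdx (NumberField.RingOfIntegers ℚ) = 1 →
      𝔭.asIdeal.inertiaDeg (NumberField.RingOfIntegers ℚ) = 1 →
    ∀ (𝔭' : IsDedekindDomain.HeightOneSpectrum (NumberField.RingOfIntegers K)),
      ((3 : ℕ) : NumberField.RingOfIntegers K) ∈ 𝔭'.asIdeal → 𝔭' ≠ 𝔭 →
    ∀ (ι' : PadicAlgCl 3 ≃+* ℂ),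
      Summit.BirchSwinnertonDyer.BirchSwinnertonDyer.Theorems.SchneiderFree.BranchInducesPrime 3 ι' 𝔭 →
    ∀ (ΩK : ℂ) (Ωp : ℂ_[3]) (L : Literature.NumberTheory.EllipticCurves.UnrSeries 3), ΩK ≠ 0 → Ωp ≠ 0 →
      Literature.NumberTheory.EllipticCurves.IsBDPLFunction ι' 𝔭 κ γ Dt.f ΩK Ωp L →
    Ideal.span {L} ≤ (AcSelmer.XAc.charIdeal (W.baseChange K) 3 κ 𝔭' ∅ γ).map (PowerSeries.map (Halves.toUnr 3))

/-! ## §2 Registered stubs (the pieces as `sorry`s; nothing else in this file is sorried) -/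

/-- STUB T1 (WEAKER — route item 24207 BY NAME; live LEAD cruxlead-24207 `ratwall_thin_comb`). -/
theorem stub_ratwall : RationalSplitIMCInclusionAtThree := by
  sorry

/-- STUB T0 (WEAKER by restriction — the wall on the `Φ = C₆`, `Dic₁₂` rows; IDEA-NEEDED, served by the LEAD). -/
theorem stub_wallOffOddTamableRows : WallOffOddTamableRows := by
  sorry

/-- STUB T2 (WEAKER · ATTACKABLE — existence of an odd CM taming lift on an odd-tamable row). -/
theorem stub_oddTamingLiftExists : OddTamingLiftExists := by
  sorry

/-- STUB T3 (ATTACKABLE — the lever: μ and torsion-ness descend as inequalities along any taming lift). -/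
theorem stub_muDescendsAlongLift : MuDescendsAlongLift := by
  sorry

/-- STUB T4 (UNDECIDED — the residual: upstairs self-μ = 0 at good supersingular, wildly ramified `w ∣ 3`, indefinite). -/
theorem stub_upstairsSelfMuZero : UpstairsSelfMuZero := by
  sorry

/-! ## §3 Compositions (kernel-checked, no `sorry`) -/

/-- A `ℤ₃`-extension has a topological generator (surjectivity field of the type). [Washington1997 §13.1] -/
theorem exists_isTopGenerator {F' : Type} [Field F'] [NumberField F'] (κ' : ZpExtension F' 3) :
    ∃ γ' : absoluteGaloisGroup F', κ'.IsTopGenerator γ' :=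
  κ'.surjective (Multiplicative.ofAdd 1)

/-- **The curve's own `μ = 0` on the odd-tamable rows from the taming lift**: choose a lift (T2), pick a topological
generator upstairs, take the upstairs package (T4) and descend it (T3). -/
theorem selfMuZeroOnOddRows_of_lift :
    OddTamingLiftExists → MuDescendsAlongLift → UpstairsSelfMuZero → SelfMuZeroOnOddTamableRows := by
  intro h2 h3 h4 W _ _ N _ K _ _ Dt hO6 hsurj hrow hr1 hN hK hH κ hκ γ _ 𝔭 hp3 he hf 𝔭' h3' hne
  obtain ⟨F', _, _, _, κ', 𝔓', hlift⟩ := h2 W hO6 hsurj hrow K hK κ hκ 𝔭 hp3 he hf 𝔭' h3' hne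
  obtain ⟨γ', hγ'⟩ := exists_isTopGenerator κ'
  haveI : Fact (κ'.IsTopGenerator γ') := ⟨hγ'⟩
  have hup : SelfMuZeroPackage W F' κ' 𝔓' γ' :=
    h4 W N K Dt hO6 hsurj hr1 hN hK hH κ hκ 𝔭 hp3 he hf 𝔭' h3' hne F' κ' γ' 𝔓' hlift
  exact h3 W K hsurj hK κ hκ γ 𝔭' h3' F' κ' γ' 𝔓' hlift hup

/-- **The wall on the odd-tamable rows from the rational wall and the rows' own `μ = 0`** (verbatim the g3 / g13
composition: 3-saturation in the domain `R₀⟦T⟧`, where `3` is prime (`prime_C_three`) and `g′` has a unit coefficient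
(`not_C_three_dvd_of_norm_coeff_eq_one`), all LANDED in `UniversalToricDescentToricTransportModThreeStubRatSqueeze`).
[folklore; Washington1997 §7.1] -/
theorem wallOnOddRows_of_ratwall_of_selfMu :
    RationalSplitIMCInclusionAtThree → SelfMuZeroOnOddTamableRows → WallOnOddTamableRows := by
  intro hR hM W _ _ N _ K _ _ Dt hO6 hsurj hrow hr1 hN hK hH κ hκ γ _ 𝔭 h3 he hf 𝔭' h3' hne ι' hι ΩK Ωp L hΩK hΩp hL
  obtain ⟨k, hk⟩ := hR W N K Dt hO6 hsurj hr1 hN hK hH κ hκ γ 𝔭 h3 he hf 𝔭' h3' hne ι' hι ΩK Ωp L hΩK hΩp hL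
  obtain ⟨-, g, hg, i, hi⟩ := hM W N K Dt hO6 hsurj hrow hr1 hN hK hH κ hκ γ 𝔭 h3 he hf 𝔭' h3' hne
  rw [hg] at hk ⊢
  have hdvd : g ∣ ((3 : ℕ) : UnrSeries 3) ^ k * L := Ideal.mem_span_singleton.mp hk
  rw [← map_natCast (PowerSeries.C (R := unrIntegers 3))] at hdvd
  exact Ideal.span_singleton_le_span_singleton.mpr
    (dvd_of_dvd_prime_pow_mul prime_C_three (not_C_three_dvd_of_norm_coeff_eq_one hi) k hdvd)

/-- Row recombination: the wall from the wall ON and OFF the odd-tamable rows (excluded middle on `OddTamableRow W`). -/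
theorem wall_of_on_of_off :
    WallOnOddTamableRows → WallOffOddTamableRows → AdditiveSplitIMCInclusionAtThree := by
  intro hon hoff W _ _ N _ K _ _ Dt hO6 hsurj hr1 hN hK hH κ hκ γ _ 𝔭 h3 he hf 𝔭' h3' hne ι' hι ΩK Ωp L hΩK hΩp hL
  by_cases hrow : OddTamableRow W
  · exact hon W N K Dt hO6 hsurj hrow hr1 hN hK hH κ hκ γ 𝔭 h3 he hf 𝔭' h3' hne ι' hι ΩK Ωp L hΩK hΩp hL
  · exact hoff W N K Dt hO6 hsurj hrow hr1 hN hK hH κ hκ γ 𝔭 h3 he hf 𝔭' h3' hne ι' hι ΩK Ωp L hΩK hΩp hL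

/-- **TOP COMPOSITION — concludes the crux `AdditiveSplitIMCInclusionAtThree` BY NAME** from the five registered stub
statements: T1 RATWALL (24207 by name), T0 the wall off the odd-tamable rows, T2 odd CM taming lift exists, T3 μ
descends along the lift, T4 upstairs self-μ = 0. -/
theorem AdditiveSplitIMCInclusionAtThree_of :
    RationalSplitIMCInclusionAtThree → WallOffOddTamableRows → OddTamingLiftExists → MuDescendsAlongLift →
      UpstairsSelfMuZero →
      Summit.BirchSwinnertonDyer.BirchSwinnertonDyer.Theses.UniversalToricDescent.AdditiveSplitIMCInclusionAtThree :=
  fun hR h0 h2 h3 h4 ↦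
    wall_of_on_of_off (wallOnOddRows_of_ratwall_of_selfMu hR (selfMuZeroOnOddRows_of_lift h2 h3 h4)) h0

/-- The crux from the registered stubs (sanity instance of the top composition; depends on the five `sorry`s). -/
theorem AdditiveSplitIMCInclusionAtThree_of_stubs :
    Summit.BirchSwinnertonDyer.BirchSwinnertonDyer.Theses.UniversalToricDescent.AdditiveSplitIMCInclusionAtThree :=
  AdditiveSplitIMCInclusionAtThree_of stub_ratwall stub_wallOffOddTamableRows stub_oddTamingLiftExists
    stub_muDescendsAlongLift stub_upstairsSelfMuZero

end Summit.BirchSwinnertonDyer.BirchSwinnertonDyer.Cruxes.AdditiveSplitIMCInclusionAtThree.TameMuDescent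

end
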